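/-
Origin: expansion seat `planner-pub-hodgecm-pv10-0`, handover #21 2026-08-18T05:07:04Z (`HOME/pub-hodgecm-pv10/lean/Pv10/ProperBaseChange.lean`, md5 8268ac37, 71 lines);
landed by the gen-6 packager in gate run 22 as `HodgeCM/PerL34/ProperBaseChange.lean` (import ^import Pv[0-9]+\.→import HodgeCM.PerL34. ×4).
-/
/-
# `C_{L₀} → C_L` is proper, from `C¹_{L₀}` compact and `|ι x|_L = |x|_{L₀}ⁿ` (kernel form of PerL l. 311)

WIP module `Pv10.ProperBaseChange` (pub-hodgecm-pv10); intended landing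
`HodgeCM/PerL34/ProperBaseChange.lean`.

PerL v5 tex ll. 310–311: "… the image of `C_{L₀}`, which injects continuously and properly: norm-one
classes are compact and `|·|_L = |·|²_{L₀}`".  With `T2Space (IdeleClassGroup L)` (K^× discrete,
`PrincipalIdelesDiscrete.lean`) and `CompactlyCoherentSpace (IdeleClassGroup L)` (residue fields finite,
`ResidueFieldsFinite.lean`) now INSTANCES, the inference is a kernel theorem whose only hypotheses are
(PRINT) `NormOneIdeleClassesCompact L₀` (C¹ compact: Cassels–Fröhlich II §16 p.121, Neukirch VI (1.6)
p.323) and (INPUT) a continuous map `ι : C_{L₀} → C_L` multiplying log-norms by a positive constant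
(for the base change of an extension of degree `n`, the constant is `n`; `n = 2` in PerL).  The map `ι`
itself (adelic base change) is not constructed — Mathlib has no API for it.  No PerL/QW8/2001 statement
is used.
-/
import Summits.HodgeConjecture.HodgeCM.PerL34.ProperCriterion
import Summits.HodgeConjecture.HodgeCM.PerL34.ClassNormProper
import Summits.HodgeConjecture.HodgeCM.PerL34.PrincipalIdelesDiscrete
import Summits.HodgeConjecture.HodgeCM.PerL34.ResidueFieldsFinite

/-! PORT of `HodgeCM/PerL34/ProperBaseChange.lean` (HodgeCMPerL run 82) — verbatim mechanical port; provenance in the PORT header line. -/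

set_option autoImplicit false

noncomputable section

open Topology Set

namespace NumberField

variable (K : Type*) [Field K] [NumberField K]
variable (L : Type*) [Field L] [NumberField L]

/-- A map into `C_L` through which a proper real-valued map factors via `log |·|_L` is proper
(`isProperMap_of_comp_factor` at `C := C_L`; the topological instance hypotheses on `C_L` are now
theorems). -/
theorem isProperMap_to_ideleClassGroup_of_factor {A : Type*} [TopologicalSpace A]
    {f : A → IdeleClassGroup L} (hf : Continuous f) {NA : A → ℝ} (hNA : IsProperMap NA)
    (h : ∀ a, NA a = logClassNorm L (f a)) : IsProperMap f :=
  isProperMap_of_comp_factor hf hNA (continuous_logClassNorm L) h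

/-- Multiplication by a nonzero real constant is a proper map. -/
theorem isProperMap_mul_left {c : ℝ} (hc : c ≠ 0) : IsProperMap fun x : ℝ => c * x :=
  (Homeomorph.mulLeft₀ c hc).isProperMap

/-- **PerL l. 311, kernel form.**  Let `ι : C_K → C_L` be continuous with
`log |ι x|_L = n · log |x|_K` for some real `n ≠ 0` (INPUT: for the adelic base change of a degree-`n`
extension `L/K` this is `|ι x|_L = |x|_Kⁿ`).  If `C¹_K` is compact (PRINT) then `ι` is a proper map;
in particular its image is closed and, if `ι` is injective, `ι` is a closed embedding. -/
theorem isProperMap_baseChange (hK : NormOneIdeleClassesCompact K)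
    {ι : IdeleClassGroup K → IdeleClassGroup L} (hι : Continuous ι) {n : ℝ} (hn : n ≠ 0)
    (hnorm : ∀ x, logClassNorm L (ι x) = n * logClassNorm K x) : IsProperMap ι :=
  isProperMap_to_ideleClassGroup_of_factor L hι
    ((isProperMap_mul_left hn).comp (isProperMap_logClassNorm K hK)) (fun x => (hnorm x).symm)

/-- Under the same hypotheses the image of `ι` is closed … -/
theorem isClosed_range_baseChange (hK : NormOneIdeleClassesCompact K)
    {ι : IdeleClassGroup K → IdeleClassGroup L} (hι : Continuous ι) {n : ℝ} (hn : n ≠ 0)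
    (hnorm : ∀ x, logClassNorm L (ι x) = n * logClassNorm K x) : IsClosed (Set.range ι) :=
  (isProperMap_baseChange K L hK hι hn hnorm).isClosedMap.isClosed_range

/-- … and an injective such `ι` is a closed embedding ("injects continuously and properly"). -/
theorem isClosedEmbedding_baseChange (hK : NormOneIdeleClassesCompact K)
    {ι : IdeleClassGroup K → IdeleClassGroup L} (hι : Continuous ι) (hinj : Function.Injective ι)
    {n : ℝ} (hn : n ≠ 0) (hnorm : ∀ x, logClassNorm L (ι x) = n * logClassNorm K x) :
    Topology.IsClosedEmbedding ι :=
  .of_continuous_injective_isClosedMap hι hinj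
    (isProperMap_baseChange K L hK hι hn hnorm).isClosedMap

end NumberField

end
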